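import Summits.AtomisticToContinuum.FouriersLaw.Theorems.BondHeatUncertaintyLinearResponseFTURBondHeatVarianceContinuityHelper8
import Summits.AtomisticToContinuum.FouriersLaw.Theorems.JunctionLocalityNonBallisticStubTimeIntegratedCurrentVarianceContinuityAux1

/-!
# Aux 2 for stub `stub_timeIntegratedCurrentVarianceContinuity` of line `drude-controls-conductance` (R1) —
# crux `JunctionLocality.NonBallistic` (stmt-AtomisticToContinuum-9127):
# δ-continuity of the stationary pairing `∫ g · (P^δ_u g) dμ_δ` of a GENERAL dominated observable at every lag

Support file (observable-agnostic re-run of Helper 8 of the landed K6b, `LinearResponseFTUR.ness_tendsto_currentPairing`,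
which is written for a single bond current `j_i`). For the pinned chain (all parameters `> 0`), under weak-NESS
uniqueness, along a steady-state family `μ`, for `T > 0`, `N ≥ 2`, a continuous observable `g` dominated as
`|g| ≤ C e^{H/(8T)}` (`C ≥ 0`) and a lag `u ≥ 0`:
`∫ g · (P^{δ}_u g) dμ_δ → ∫ g · (P^{0}_u g) dμ_T` as `δ → 0`, `δ ≠ 0`, where `P^δ` are the kernels at temperatures
`T ± δ/2` and `μ_δ = μ N (T+δ/2) (T-δ/2)` (`nessTendstoObsPairing`). The `3ε` argument of Helper 8 verbatim with
`j_i ↦ g`: energy truncation `g ↦ χ_K g` costs `≤ e(K) → 0` uniformly in `δ` (Aux 1 `pairingCutoffApproxObs` with the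
uniform moments `LinearResponseFTUR.ness_uniform_exp_moment`); for the truncated, compactly supported observable,
`P^δ_u(χ_K g) → P^0_u(χ_K g)` uniformly on the support (`LinearResponseFTUR.pinnedChain_integral_solMap_tendsto_temperature`)
and `(χ_K g) · P^0_u(χ_K g)` is bounded continuous (Feller), so the weak convergence
`LinearResponseFTUR.ness_tendsto_integral` applies. Used with `g = J_tot` in the stub. Nothing here closes an item.
-/

noncomputable section

namespace Summit.AtomisticToContinuum.FouriersLaw.Theorems.NonBallistic

open MeasureTheory ProbabilityTheory Filter Topology Set
open scoped NNReal ENNReal Topology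
open Literature.MathematicalPhysics.KineticTheory.HeatConduction Literature.Probability.Process OscillatorChain
open Summit.AtomisticToContinuum.FouriersLaw.Theorems.BondHeatUncertainty
open Summit.AtomisticToContinuum.FouriersLaw.Theorems.LinearResponseFTUR

/-- **δ-continuity of the stationary pairing of a general dominated observable at a fixed lag** (registered
sub-goal of `stub_timeIntegratedCurrentVarianceContinuity`; the observable-agnostic twin of K6b's
`LinearResponseFTUR.ness_tendsto_currentPairing`): for the pinned chain (all parameters `> 0`), under weak-NESS
uniqueness and along a steady-state family `μ`, for `T > 0`, `N ≥ 2`, a continuous `g` with `|g| ≤ C e^{H/(8T)}`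
(`C ≥ 0`; the exponent is written `1/(2T)/4`) and `u ≥ 0`,
`∫ g (P^{T+δ/2,T-δ/2}_u g) dμ_{N,T+δ/2,T-δ/2} → ∫ g (P^{T,T}_u g) dμ_{N,T,T}` as `δ → 0`, `δ ≠ 0`. [folklore] -/
theorem nessTendstoObsPairing :
    ∀ ω₂ lam β γ : ℝ, 0 < ω₂ → 0 < lam → 0 < β → 0 < γ →
    (∀ (N : ℕ) (T_L T_R : ℝ), 0 < T_L → 0 < T_R → ∀ μ ν : Measure (PhaseSpace N),
      (pinnedChain ω₂ lam β γ).IsSteadyState N T_L T_R μ →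
      (pinnedChain ω₂ lam β γ).IsSteadyState N T_L T_R ν → μ = ν) →
    ∀ μ : (N : ℕ) → ℝ → ℝ → Measure (PhaseSpace N),
      (∀ (N : ℕ) (T_L T_R : ℝ), 0 < T_L → 0 < T_R →
        (pinnedChain ω₂ lam β γ).IsSteadyState N T_L T_R (μ N T_L T_R)) →
    ∀ T : ℝ, 0 < T → ∀ N : ℕ, 2 ≤ N → ∀ g : PhaseSpace N → ℝ, Continuous g → ∀ C : ℝ, 0 ≤ C →
      (∀ x, |g x| ≤ C * Real.exp (1 / (2 * T) / 4 * (pinnedChain ω₂ lam β γ).hamiltonian N x)) →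
      ∀ u : ℝ, 0 ≤ u →
      Tendsto (fun δ : ℝ => ∫ y, g y *
          (∫ y', g y' ∂((pinnedChain ω₂ lam β γ).transitionKernel N (T + δ / 2) (T - δ / 2) u.toNNReal y))
          ∂(μ N (T + δ / 2) (T - δ / 2))) (𝓝[≠] 0)
        (𝓝 (∫ y, g y * (∫ y', g y' ∂((pinnedChain ω₂ lam β γ).transitionKernel N T T u.toNNReal y))
          ∂(μ N T T))) := by
  intro ω₂ lam β γ hω hl hβ hγ huniq μ hμ T hT N hN g hgc C hC0 hC u hu
  set P := pinnedChain ω₂ lam β γ with hP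
  set H := P.hamiltonian N with hH
  have hHc : Continuous H := pinnedChain_continuous_hamiltonian ω₂ lam β γ N
  have hN0 : 0 < N := by omega
  set ϑ : ℝ := 1 / (2 * T) with hϑ
  have hϑ0 : 0 < ϑ := by positivity
  obtain ⟨M, hM⟩ := ness_uniform_exp_moment ω₂ lam β γ hω hl hβ hγ huniq μ hμ T hT N hN
  have hMnn : 0 ≤ M := by
    have h := hM 0 (by simpa using hT.le)
    exact le_trans (integral_nonneg fun x => (Real.exp_pos _).le) h.2
  -- the box `|δ| ≤ T`
  have hpos : ∀ δ : ℝ, |δ| ≤ T → 0 < T + δ / 2 ∧ 0 < T - δ / 2 := fun δ hδ => by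
    have h := abs_le.1 hδ
    exact ⟨by linarith only [hT, h.1], by linarith only [hT, h.2]⟩
  have hprob : ∀ δ : ℝ, |δ| ≤ T → IsProbabilityMeasure (μ N (T + δ / 2) (T - δ / 2)) := fun δ hδ =>
    (hμ N _ _ (hpos δ hδ).1 (hpos δ hδ).2).1
  have hinv : ∀ δ : ℝ, |δ| ≤ T → ∀ s : ℝ≥0,
      (μ N (T + δ / 2) (T - δ / 2)).bind (P.transitionKernel N (T + δ / 2) (T - δ / 2) s) =
        μ N (T + δ / 2) (T - δ / 2) := fun δ hδ =>
    (ness_facts ω₂ lam β γ hω hl hβ hγ huniq μ hμ N hN _ _ (hpos δ hδ).1 (hpos δ hδ).2).2.1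
  have hϑab : ∀ δ : ℝ, |δ| ≤ T → ϑ / 4 < 1 / max (T + δ / 2) (T - δ / 2) := fun δ hδ => by
    have h := abs_le.1 hδ
    have hm : max (T + δ / 2) (T - δ / 2) ≤ 2 * T := max_le (by linarith only [h.2, hT]) (by linarith only [h.1, hT])
    have hm0 : 0 < max (T + δ / 2) (T - δ / 2) := lt_max_of_lt_left (hpos δ hδ).1
    rw [hϑ, lt_div_iff₀ hm0]
    calc 1 / (2 * T) / 4 * max (T + δ / 2) (T - δ / 2) ≤ 1 / (2 * T) / 4 * (2 * T) :=
          mul_le_mul_of_nonneg_left hm (by positivity)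
      _ = 1 / 4 := by field_simp
      _ < 1 := by norm_num
  have hzero : |(0 : ℝ)| ≤ T := by simpa using hT.le
  -- the pairings
  obtain ⟨F, hF⟩ : ∃ F : ℝ → ℝ, ∀ δ, F δ = ∫ y, g y * (∫ y', g y'
      ∂(P.transitionKernel N (T + δ / 2) (T - δ / 2) u.toNNReal y)) ∂(μ N (T + δ / 2) (T - δ / 2)) :=
    ⟨_, fun _ => rfl⟩
  obtain ⟨FK, hFK⟩ : ∃ FK : ℝ → ℝ → ℝ, ∀ K δ, FK K δ = ∫ y, (max 0 (min 1 (K + 1 - H y)) * g y) *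
      (∫ y', (max 0 (min 1 (K + 1 - H y')) * g y')
        ∂(P.transitionKernel N (T + δ / 2) (T - δ / 2) u.toNNReal y)) ∂(μ N (T + δ / 2) (T - δ / 2)) :=
    ⟨_, fun _ _ => rfl⟩
  -- the target, rewritten through `F`
  have hgoal : (fun δ : ℝ => ∫ y, g y * (∫ y', g y'
      ∂(P.transitionKernel N (T + δ / 2) (T - δ / 2) u.toNNReal y)) ∂(μ N (T + δ / 2) (T - δ / 2))) = F :=
    funext fun δ => (hF δ).symm
  have hF0 : F 0 = ∫ y, g y * (∫ y', g y' ∂(P.transitionKernel N T T u.toNNReal y)) ∂(μ N T T) := by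
    rw [hF]; simp only [zero_div, add_zero, sub_zero]
  rw [hgoal, ← hF0]
  ----------------------------------------------------------------
  -- Step A: energy truncation, uniformly in `δ`
  ----------------------------------------------------------------
  set e : ℝ → ℝ := fun K => 2 * Real.sqrt (C ^ 2 * Real.exp (-(ϑ / 2 * K)) * (M + 1)) * (1 + C ^ 2 * M)
    with he
  have hA : ∀ K δ, |δ| ≤ T → |F δ - FK K δ| ≤ e K := by
    intro K δ hδ
    haveI := hprob δ hδ
    rw [hF, hFK]
    exact pairingCutoffApproxObs ω₂ lam β γ hω hl.le hβ.le hγ.le N hN0 _ _ (μ N (T + δ / 2) (T - δ / 2))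
      inferInstance (hinv δ hδ) (hpos δ hδ).1 (hpos δ hδ).2 ϑ M C hϑ0 (hϑab δ hδ) (hM δ hδ).1 (hM δ hδ).2 g hgc
      hC0 hC u K
  have he0 : Tendsto e atTop (𝓝 0) := by
    have h1 : Tendsto (fun K : ℝ => C ^ 2 * Real.exp (-(ϑ / 2 * K)) * (M + 1)) atTop (𝓝 (C ^ 2 * 0 * (M + 1))) :=
      ((Real.tendsto_exp_neg_atTop_nhds_zero.comp (tendsto_id.const_mul_atTop (by positivity : 0 < ϑ / 2))).const_mul
        (C ^ 2)).mul_const (M + 1)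
    rw [mul_zero, zero_mul] at h1
    have h2 := ((Real.continuous_sqrt.tendsto 0).comp h1)
    rw [Real.sqrt_zero] at h2
    have h3 := (h2.const_mul 2).mul_const (1 + C ^ 2 * M)
    rw [mul_zero, zero_mul] at h3
    exact h3
  ----------------------------------------------------------------
  -- Step B: for the truncated observable, `FK K δ → FK K 0`
  ----------------------------------------------------------------
  have hB : ∀ K : ℝ, Tendsto (FK K) (𝓝[≠] 0) (𝓝 (FK K 0)) := by
    intro K
    set χ : PhaseSpace N → ℝ := fun x => max 0 (min 1 (K + 1 - H x)) with hχ
    have hχc : Continuous χ := continuous_const.max (continuous_const.min (continuous_const.sub hHc))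
    have hχ0 : ∀ x, 0 ≤ χ x := fun x => le_max_left _ _
    have hχ1 : ∀ x, χ x ≤ 1 := fun x => max_le zero_le_one (min_le_left _ _)
    have hχ_zero : ∀ x, K + 1 ≤ H x → χ x = 0 := fun x hx => by
      show max 0 (min 1 (K + 1 - H x)) = 0
      rw [max_eq_left]
      exact min_le_of_right_le (by linarith only [hx])
    set gK : PhaseSpace N → ℝ := fun x => χ x * g x with hgK
    have hgKc : Continuous gK := hχc.mul hgc
    set JK : ℝ := C * Real.exp (ϑ / 4 * (K + 1)) with hJK
    have hJK0 : 0 ≤ JK := by positivity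
    have hgK_bd : ∀ x, |gK x| ≤ JK := by
      intro x
      show |χ x * g x| ≤ JK
      by_cases hx : H x ≤ K + 1
      · rw [abs_mul, abs_of_nonneg (hχ0 x)]
        calc χ x * |g x| ≤ 1 * |g x| := mul_le_mul_of_nonneg_right (hχ1 x) (abs_nonneg _)
          _ ≤ C * Real.exp (ϑ / 4 * H x) := by rw [one_mul]; exact hC x
          _ ≤ JK := mul_le_mul_of_nonneg_left (Real.exp_le_exp.2 (mul_le_mul_of_nonneg_left hx (by positivity)))
              hC0
      · rw [hχ_zero x (le_of_lt (not_le.1 hx)), zero_mul, abs_zero]; exact hJK0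
    have hgK_bd' : ∀ x, ‖gK x‖ ≤ JK := fun x => by rw [Real.norm_eq_abs]; exact hgK_bd x
    have hgK_supp : HasCompactSupport gK := by
      refine HasCompactSupport.intro (pinnedChain_isCompact_setOf_hamiltonian_le hω hl.le hβ.le γ N (K + 1)) ?_
      intro x hx
      have hx' : K + 1 ≤ H x := le_of_lt (not_le.1 hx)
      show χ x * g x = 0
      rw [hχ_zero x hx', zero_mul]
    -- the kernel averages of `gK`
    have hA_bd : ∀ (a b : ℝ) (y : PhaseSpace N), |∫ y', gK y' ∂(P.transitionKernel N a b u.toNNReal y)| ≤ JK := by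
      intro a b y
      haveI := pinnedChain_isMarkovKernel_transitionKernel hω hl.le hβ.le hγ.le N a b u.toNNReal
      rw [← Real.norm_eq_abs]
      refine (norm_integral_le_of_norm_le_const (Eventually.of_forall hgK_bd')).trans ?_
      simp
    have hA_sm : ∀ a b : ℝ, StronglyMeasurable fun y => ∫ y', gK y' ∂(P.transitionKernel N a b u.toNNReal y) := by
      intro a b
      haveI := pinnedChain_isMarkovKernel_transitionKernel hω hl.le hβ.le hγ.le N a b u.toNNReal
      exact StronglyMeasurable.integral_kernel_prod_right' (κ := P.transitionKernel N a b u.toNNReal)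
        (hgKc.measurable.comp measurable_snd).stronglyMeasurable
    have hA0c : Continuous fun y => ∫ y', gK y' ∂(P.transitionKernel N T T u.toNNReal y) :=
      pinnedChain_continuous_integral_transitionKernel hω hl.le hβ.le hγ.le N T T u.toNNReal hgKc hgK_bd'
    -- (B1) weak convergence on the bounded continuous `gK · P⁰_u gK`
    set g0 : PhaseSpace N → ℝ := fun y => gK y * ∫ y', gK y' ∂(P.transitionKernel N T T u.toNNReal y) with hg0
    have hg0c : Continuous g0 := hgKc.mul hA0c
    have hg0b : ∀ y, |g0 y| ≤ JK * JK := fun y => by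
      show |gK y * ∫ y', gK y' ∂(P.transitionKernel N T T u.toNNReal y)| ≤ JK * JK
      rw [abs_mul]
      exact mul_le_mul (hgK_bd y) (hA_bd T T y) (abs_nonneg _) hJK0
    have hB1 := ness_tendsto_integral ω₂ lam β γ hω hl hβ hγ huniq μ hμ T hT N hN g0 hg0c (JK * JK) hg0b
    -- (B2) the kernels at `T ± δ/2` versus `T`, uniformly on the support of `gK`
    have hB2 : ∀ ε > 0, ∃ δ₀ > 0, ∀ δ : ℝ, |δ| < δ₀ → |δ| ≤ T →
        |FK K δ - ∫ y, g0 y ∂(μ N (T + δ / 2) (T - δ / 2))| ≤ JK * ε := by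
      intro ε hε
      obtain ⟨δ₀, hδ₀, hker⟩ := pinnedChain_integral_solMap_tendsto_temperature ω₂ lam β γ hω hl.le hβ.le hγ.le
        N T hT gK hgKc hgK_supp (K + 1) u hu ε hε
      refine ⟨δ₀, hδ₀, fun δ hδ hδT => ?_⟩
      haveI := hprob δ hδT
      set ρ := μ N (T + δ / 2) (T - δ / 2) with hρ
      have hu' : ((u.toNNReal : ℝ≥0) : ℝ) = u := Real.coe_toNNReal u hu
      -- pointwise bound
      have hpt : ∀ y, ‖gK y * (∫ y', gK y' ∂(P.transitionKernel N (T + δ / 2) (T - δ / 2) u.toNNReal y)) - g0 y‖ ≤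
          JK * ε := by
        intro y
        show ‖gK y * (∫ y', gK y' ∂(P.transitionKernel N (T + δ / 2) (T - δ / 2) u.toNNReal y)) -
          gK y * ∫ y', gK y' ∂(P.transitionKernel N T T u.toNNReal y)‖ ≤ JK * ε
        rw [← mul_sub, norm_mul, Real.norm_eq_abs, Real.norm_eq_abs]
        by_cases hy : H y ≤ K + 1
        · refine mul_le_mul (hgK_bd y) ?_ (abs_nonneg _) hJK0
          have h := hker δ hδ y hy
          rw [pinnedChain_integral_transitionKernel hω hl.le hβ.le hγ.le N _ _ u.toNNReal y hgKc.aestronglyMeasurable,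
            pinnedChain_integral_transitionKernel hω hl.le hβ.le hγ.le N _ _ u.toNNReal y hgKc.aestronglyMeasurable, hu']
          exact h
        · have : gK y = 0 := by
            show χ y * g y = 0
            rw [hχ_zero y (le_of_lt (not_le.1 hy)), zero_mul]
          rw [this, abs_zero, zero_mul]
          positivity
      have hI1 : Integrable (fun y => gK y * ∫ y', gK y' ∂(P.transitionKernel N (T + δ / 2) (T - δ / 2) u.toNNReal y)) ρ :=
        (integrable_const (JK * JK)).mono' (hgKc.aestronglyMeasurable.mul (hA_sm _ _).aestronglyMeasurable)
          (Eventually.of_forall fun y => by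
            rw [norm_mul, Real.norm_eq_abs, Real.norm_eq_abs]
            exact mul_le_mul (hgK_bd y) (hA_bd _ _ y) (abs_nonneg _) hJK0)
      have hI2 : Integrable g0 ρ :=
        (integrable_const (JK * JK)).mono' hg0c.aestronglyMeasurable
          (Eventually.of_forall fun y => by rw [Real.norm_eq_abs]; exact hg0b y)
      rw [hFK, ← Real.norm_eq_abs, ← integral_sub hI1 hI2]
      refine (norm_integral_le_of_norm_le_const (Eventually.of_forall hpt)).trans ?_
      simp
    -- combine (B1) and (B2)
    have hFK0 : FK K 0 = ∫ y, g0 y ∂(μ N T T) := by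
      rw [hFK]; simp only [zero_div, add_zero, sub_zero, hg0, hgK, hχ]
    rw [Metric.tendsto_nhds]
    intro ε hε
    obtain ⟨δ₀, hδ₀, hB2'⟩ := hB2 (ε / (2 * (JK + 1))) (by positivity)
    rw [Metric.tendsto_nhds] at hB1
    have hbox : ∀ᶠ δ : ℝ in 𝓝[≠] 0, |δ| ≤ T ∧ |δ| < δ₀ := by
      have h1 : Metric.closedBall (0 : ℝ) T ∈ 𝓝[≠] (0 : ℝ) :=
        mem_nhdsWithin_of_mem_nhds (Metric.closedBall_mem_nhds 0 hT)
      have h2 : Metric.ball (0 : ℝ) δ₀ ∈ 𝓝[≠] (0 : ℝ) := mem_nhdsWithin_of_mem_nhds (Metric.ball_mem_nhds 0 hδ₀)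
      filter_upwards [h1, h2] with δ hδ1 hδ2
      exact ⟨by simpa [Real.dist_eq] using hδ1, by simpa [Real.dist_eq] using hδ2⟩
    filter_upwards [hB1 (ε / 2) (by positivity), hbox] with δ hδ1 hδ2
    rw [hFK0, Real.dist_eq]
    have h2 := hB2' δ hδ2.2 hδ2.1
    rw [Real.dist_eq] at hδ1
    have h3 : JK * (ε / (2 * (JK + 1))) < ε / 2 := by
      rw [mul_div_assoc', div_lt_div_iff₀ (by positivity) (by positivity)]
      nlinarith only [hε, hJK0]
    calc |FK K δ - ∫ y, g0 y ∂(μ N T T)|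
        ≤ |FK K δ - ∫ y, g0 y ∂(μ N (T + δ / 2) (T - δ / 2))| +
          |(∫ y, g0 y ∂(μ N (T + δ / 2) (T - δ / 2))) - ∫ y, g0 y ∂(μ N T T)| := abs_sub_le _ _ _
      _ < ε / 2 + ε / 2 := add_lt_add (h2.trans_lt h3) hδ1
      _ = ε := by ring
  ----------------------------------------------------------------
  -- Step C: the `3ε` argument
  ----------------------------------------------------------------
  rw [Metric.tendsto_nhds]
  intro ε hε
  obtain ⟨K, hK⟩ : ∃ K : ℝ, e K < ε / 3 := ((he0.eventually (gt_mem_nhds (by positivity))).exists)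
  have hBK := hB K
  rw [Metric.tendsto_nhds] at hBK
  have hbox : ∀ᶠ δ : ℝ in 𝓝[≠] 0, |δ| ≤ T := by
    have h1 : Metric.closedBall (0 : ℝ) T ∈ 𝓝[≠] (0 : ℝ) :=
      mem_nhdsWithin_of_mem_nhds (Metric.closedBall_mem_nhds 0 hT)
    filter_upwards [h1] with δ hδ1
    simpa [Real.dist_eq] using hδ1
  filter_upwards [hBK (ε / 3) (by positivity), hbox] with δ hδ1 hδ2
  rw [Real.dist_eq] at hδ1 ⊢
  have h1 := hA K δ hδ2
  have h3 := hA K 0 hzero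
  calc |F δ - F 0| ≤ |F δ - FK K δ| + |FK K δ - F 0| := abs_sub_le _ _ _
    _ ≤ |F δ - FK K δ| + (|FK K δ - FK K 0| + |FK K 0 - F 0|) := by
        gcongr
        exact abs_sub_le _ _ _
    _ < ε / 3 + (ε / 3 + ε / 3) := by
        refine add_lt_add_of_le_of_lt (h1.trans hK.le) (add_lt_add_of_lt_of_le hδ1 ?_)
        rw [abs_sub_comm]; exact h3.trans hK.le
    _ = ε := by ring

end Summit.AtomisticToContinuum.FouriersLaw.Theorems.NonBallistic

end
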